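import Mathlib
import Summits.Ventures.PercRepro2.SwOutMixedArmsPlusCube

/-!
# The slab cubes under AL⁺, with pieces (blind cell PercRepro2, night-4 g21, 2026-08-27;
proofs/NIGHT4-G21.md §6)

The unmixed non-leaking points of a slice are partitioned by g20's slab cubes: for `A : Finset ρ`,
`slabPt A f₀ y` has slab bit `y(⋆)` (all u-arms of that colour), the arms of `A` attached when
`y(⋆) = true` and dropped-blue when `y(⋆) = false`, the other arms free (`uP = ¬y(⋆)`, pieces and
outside bits = the free coordinates).  Under AL⁺ the points of `Q` in a slab cube form a LOWER SET
of the cube (`slab_lower`: the slab move drops the u–p classes of `A` with a red u-arm before and a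
blue one after, and raises the others), the red set is monotone on the cube and the `f`-frozen
blue set is the red set of the flipped cube point — so the cube principle applies to each cube
(`slab_cube_le`).  The core points of the cube are its two overlap points `oPtA` (top, the
minimum of the top level) and `obPtA` (bottom, the maximum of the bottom level), antipodal, with
`ER oPtA = EBT obPtA`; removing the top core point from the left and the bottom core point from
the right keeps the inequality (`slab_step`): when both are in `Q` the removed terms are equal;
when the bottom one is absent nothing is removed on the right; when the top one is absent the cube
is the full bottom level and the involution flipping the free pieces is an explicit injection that
never needs the bottom core point.
-/

namespace Summit.Ventures.PercRepro2

namespace MixedArms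

open scoped Classical

variable {ι ρ ν κ : Type*}

section SlabVocab

variable [DecidableEq ρ] (arm : ν → ρ) (A : Finset ρ)

/-- The slab cube point of `A` on the slice `f₀`. -/
def slabPt (f₀ : Config κ) (y : Config (CubeA arm A)) : PtR ι ρ ν κ :=
  (fun _ => y (Sum.inl ()),
    fun i => if h : arm i ∈ A then y (Sum.inl ()) else y (Sum.inr (Sum.inl ⟨i, h⟩)),
    fun r => if r ∈ A then y (Sum.inl ()) else !y (Sum.inl ()),
    fun r => if h : r ∈ A then y (Sum.inl ()) else y (Sum.inr (Sum.inr ⟨r, h⟩)),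
    f₀)

/-- The bottom point of a slice (everything blue but the far arms). -/
def botFA (f₀ : Config κ) : PtR ι ρ ν κ :=
  ((fun _ => false), (fun _ => false), (fun _ => false), (fun _ => false), f₀)

/-- The flip of the free pieces of a slab cube point. -/
def flipPieces (y : Config (CubeA arm A)) : Config (CubeA arm A) :=
  Sum.elim (fun _ => y (Sum.inl ())) (Sum.elim (fun i => !y (Sum.inr (Sum.inl i)))
    (fun r => y (Sum.inr (Sum.inr r))))

/-- The top overlap point `oPtA = (⊤, 1_A)`. -/
def oPtA (f₀ : Config κ) : PtR ι ρ ν κ :=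
  slabPt arm A f₀ (Sum.elim (fun _ => true) (fun _ => false))

/-- The bottom overlap point `obPtA = (⊥, 1_{Aᶜ})`. -/
def obPtA (f₀ : Config κ) : PtR ι ρ ν κ :=
  slabPt arm A f₀ (Sum.elim (fun _ => false) (fun _ => true))

variable {arm A}

/-- The slab projection inverts the slab cube. -/
lemma projA_slabPt [Nonempty ι] (f₀ : Config κ) (y : Config (CubeA arm A)) :
    projA arm A (slabPt arm A f₀ y : PtR ι ρ ν κ) = y := by
  funext t
  rcases t with ⟨⟨⟩⟩ | ⟨i, hi⟩ | ⟨r, hr⟩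
  · rfl
  · simp only [projA, slabPt, Sum.elim_inl, Sum.elim_inr, dif_neg hi]
  · simp only [projA, slabPt, Sum.elim_inr, dif_neg hr]

/-- The index of a slab cube point is `A`. -/
lemma idxA_slabPt [Nonempty ι] [Fintype ρ] (f₀ : Config κ) (y : Config (CubeA arm A)) :
    idxA (slabPt arm A f₀ y : PtR ι ρ ν κ) = A := by
  ext r
  rw [idxA, Finset.mem_filter]
  simp only [Finset.mem_univ, true_and, slabPt, y0]
  by_cases h : r ∈ A
  · simp only [h, if_true]
  · simp only [h, if_false, iff_false]
    cases y (Sum.inl ()) <;> decide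

/-- A slab cube point is unmixed. -/
lemma unmixed_slabPt [Nonempty ι] (f₀ : Config κ) (y : Config (CubeA arm A)) :
    ∀ j, (slabPt arm A f₀ y : PtR ι ρ ν κ).1 j = y0 (slabPt arm A f₀ y : PtR ι ρ ν κ) :=
  fun _ => rfl

/-- A slab cube point does not leak. -/
lemma not_leak_slabPt (f₀ : Config κ) (y : Config (CubeA arm A)) :
    ¬ Leak (slabPt arm A f₀ y : PtR ι ρ ν κ) arm := by
  cases hY : y (Sum.inl ())
  · refine not_leak_of_bslab arm ⟨?_, fun r => ?_⟩
    · funext j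
      simp only [slabPt, hY]
    · by_cases hr : r ∈ A
      · right
        refine ⟨fun i hi => ?_, ?_⟩
        · simp only [slabPt, hi, hr, dif_pos, hY]
        · simp only [slabPt, hr, dif_pos, hY]
      · left
        simp only [slabPt, hr, if_false, hY, Bool.not_false]
  · refine not_leak_of_tslab arm ⟨?_, fun r => ?_⟩
    · funext j
      simp only [slabPt, hY]
    · by_cases hr : r ∈ A
      · right
        refine ⟨fun i hi => ?_, ?_⟩
        · simp only [slabPt, hi, hr, dif_pos, hY]
        · simp only [slabPt, hr, dif_pos, hY]
      · left
        simp only [slabPt, hr, if_false, hY, Bool.not_true]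

/-- The slab cube point of the projection of an unmixed non-leaking point of index `A` on the
slice is the point. -/
lemma slabPt_projA [Nonempty ι] [Fintype ρ] {f₀ : Config κ} {p : PtR ι ρ ν κ}
    (hp : ¬ Leak p arm) (hu : ∀ j, p.1 j = y0 p) (hf : p.2.2.2.2 = f₀) (hA : idxA p = A) :
    slabPt arm A f₀ (projA arm A p) = p := by
  have hmem : ∀ r, r ∈ A ↔ p.2.2.1 r = y0 p := by
    intro r
    rw [← hA, idxA, Finset.mem_filter]
    simp only [Finset.mem_univ, true_and]
  obtain ⟨s, a, uP, e, f⟩ := p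
  simp only at hu hf hmem
  subst hf
  simp only [slabPt, projA, Sum.elim_inl, Sum.elim_inr, Prod.mk.injEq]
  have hs : (fun _ : ι => y0 (s, a, uP, e, f)) = s := by
    funext j
    exact (hu j).symm
  refine ⟨hs, ?_, ?_, ?_, trivial⟩
  · funext i
    by_cases h : arm i ∈ A
    · rw [dif_pos h]
      have huP := (hmem (arm i)).1 h
      cases hY : y0 (s, a, uP, e, f)
      · rw [hY] at huP
        exact (piece_of_blue' hp ⟨Classical.arbitrary ι, by show s _ = _; rw [hu, hY]⟩ i huP).symm
      · rw [hY] at huP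
        exact (piece_of_red' hp ⟨Classical.arbitrary ι, by show s _ = _; rw [hu, hY]⟩ i huP).symm
    · rw [dif_neg h]
  · funext r
    by_cases h : r ∈ A
    · rw [if_pos h]
      exact ((hmem r).1 h).symm
    · rw [if_neg h]
      have := (not_iff_not.2 (hmem r)).1 h
      cases hY : y0 (s, a, uP, e, f) <;> rw [hY] at this <;> cases huP : uP r <;> simp_all
  · funext r
    by_cases h : r ∈ A
    · rw [dif_pos h]
      have huP := (hmem r).1 h
      cases hY : y0 (s, a, uP, e, f)
      · rw [hY] at huP
        have := Bool.le_iff_imp.1 (e_le_uP_of_blue' hp ⟨Classical.arbitrary ι, by show s _ = _; rw [hu, hY]⟩ r)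
        cases he : e r
        · rfl
        · exact absurd (this he) (by show ¬ uP r = true; rw [huP]; decide)
      · rw [hY] at huP
        exact (Bool.le_iff_imp.1 (uP_le_e_of_red' hp ⟨Classical.arbitrary ι, by show s _ = _; rw [hu, hY]⟩ r)
          huP).symm
    · rw [dif_neg h]

/-- The red set is monotone on the slab cube. -/
lemma ER_slabPt_mono (f₀ : Config κ) :
    Monotone (fun y : Config (CubeA arm A) => ER (slabPt arm A f₀ y : PtR ι ρ ν κ)) := by
  intro y y' h x hx
  rcases x with j | ⟨⟨⟩⟩ | i | r | k
  · exact Bool.le_iff_imp.1 (h (Sum.inl ())) hx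
  · obtain ⟨j, hj⟩ := hx
    exact ⟨j, Bool.le_iff_imp.1 (h (Sum.inl ())) hj⟩
  · simp only [mem_ER_a, slabPt] at hx ⊢
    split_ifs at hx ⊢ with hi
    · exact Bool.le_iff_imp.1 (h (Sum.inl ())) hx
    · exact Bool.le_iff_imp.1 (h _) hx
  · obtain ⟨⟨j, hj⟩, hp⟩ := hx
    refine ⟨⟨j, Bool.le_iff_imp.1 (h (Sum.inl ())) hj⟩, ?_⟩
    simp only [slabPt] at hp ⊢
    split_ifs at hp ⊢ with hr
    · exact Bool.le_iff_imp.1 (h (Sum.inl ())) hp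
    · have hY := Bool.le_iff_imp.1 (h (Sum.inl ())) hj
      simp only [slabPt] at hj
      rw [hj] at hp
      exact absurd hp (by decide)
  · exact hx

/-- The `f`-frozen flip of a slab cube point is the slab cube point of the flipped cube point. -/
lemma flipT_empty_slabPt [DecidableEq κ] (f₀ : Config κ) (y : Config (CubeA arm A)) :
    flipT ∅ (slabPt arm A f₀ y : PtR ι ρ ν κ) = slabPt arm A f₀ (flipAll y) := by
  simp only [flipT, slabPt, Prod.mk.injEq]
  refine ⟨rfl, ?_, ?_, ?_, ?_⟩
  · funext i
    simp only [flipAll]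
    split_ifs <;> rfl
  · funext r
    simp only [flipAll]
    split_ifs <;> simp
  · funext r
    simp only [flipAll]
    split_ifs <;> rfl
  · funext k
    simp only [Finset.notMem_empty, if_false]

/-- The `f`-frozen blue set of a slab cube point. -/
lemma EBT_slabPt [DecidableEq κ] (f₀ : Config κ) (y : Config (CubeA arm A)) :
    EBT ∅ (slabPt arm A f₀ y : PtR ι ρ ν κ) = ER (slabPt arm A f₀ (flipAll y) : PtR ι ρ ν κ) := by
  unfold EBT
  rw [flipT_empty_slabPt]

omit [DecidableEq ρ] in
/-- The flip of the two overlap points. -/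
lemma flipAll_elim_top_bot :
    flipAll (Sum.elim (fun _ => true) (fun _ => false) : Config (CubeA arm A)) =
      Sum.elim (fun _ => false) (fun _ => true) := by
  funext t
  rcases t with ⟨⟨⟩⟩ | t <;> rfl

/-- `ER oPtA = EBT obPtA`. -/
lemma ER_oPtA_eq_EBT_obPtA [DecidableEq κ] (f₀ : Config κ) :
    ER (oPtA arm A f₀ : PtR ι ρ ν κ) = EBT ∅ (obPtA arm A f₀ : PtR ι ρ ν κ) := by
  rw [obPtA, EBT_slabPt, ← flipAll_elim_top_bot, flipAll_involutive]
  rfl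

/-- The top overlap point is a core point with every u-arm red. -/
lemma core_oPtA [Nonempty ι] (f₀ : Config κ) :
    Core (oPtA arm A f₀ : PtR ι ρ ν κ) arm ∧ ∃ j, (oPtA arm A f₀ : PtR ι ρ ν κ).1 j = true := by
  refine ⟨⟨fun i => ?_, fun r => ?_⟩, ⟨Classical.arbitrary ι, rfl⟩⟩
  · simp only [oPtA, slabPt, Sum.elim_inl, Sum.elim_inr]
    split_ifs <;> rfl
  · simp only [oPtA, slabPt, Sum.elim_inl, Sum.elim_inr]
    split_ifs <;> rfl

/-- The bottom overlap point is a core point with every u-arm blue. -/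
lemma core_obPtA [Nonempty ι] (f₀ : Config κ) :
    Core (obPtA arm A f₀ : PtR ι ρ ν κ) arm ∧ ∃ j, (obPtA arm A f₀ : PtR ι ρ ν κ).1 j = false := by
  refine ⟨⟨fun i => ?_, fun r => ?_⟩, ⟨Classical.arbitrary ι, rfl⟩⟩
  · simp only [obPtA, slabPt, Sum.elim_inl, Sum.elim_inr]
    split_ifs <;> rfl
  · simp only [obPtA, slabPt, Sum.elim_inl, Sum.elim_inr]
    split_ifs <;> rfl

/-- A core point of the slab cube with a red u-arm is the top overlap point. -/
lemma eq_oPtA_of_core [Nonempty ι] [Fintype ρ] {f₀ : Config κ} {p : PtR ι ρ ν κ}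
    (hp : ¬ Leak p arm) (hu : ∀ j, p.1 j = y0 p) (hf : p.2.2.2.2 = f₀) (hA : idxA p = A)
    (hc : Core p arm) (hs : ∃ j, p.1 j = true) : p = oPtA arm A f₀ := by
  have hY : y0 p = true := by
    obtain ⟨j, hj⟩ := hs
    rw [← hu j, hj]
  rw [← slabPt_projA hp hu hf hA, oPtA]
  congr 1
  funext t
  rcases t with ⟨⟨⟩⟩ | ⟨i, hi⟩ | ⟨r, hr⟩
  · simpa [projA] using hY
  · simp only [projA, Sum.elim_inl, Sum.elim_inr]
    rw [hc.1 i]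
    have := (not_iff_not.2 (show arm i ∈ A ↔ p.2.2.1 (arm i) = y0 p by
      rw [← hA, idxA, Finset.mem_filter]; simp only [Finset.mem_univ, true_and])).1 hi
    rw [hY] at this
    simpa using this
  · simp only [projA, Sum.elim_inr]
    rw [← hc.2 r]
    have := (not_iff_not.2 (show r ∈ A ↔ p.2.2.1 r = y0 p by
      rw [← hA, idxA, Finset.mem_filter]; simp only [Finset.mem_univ, true_and])).1 hr
    rw [hY] at this
    simpa using this

/-- A core point of the slab cube with a blue u-arm is the bottom overlap point. -/
lemma eq_obPtA_of_core [Nonempty ι] [Fintype ρ] {f₀ : Config κ} {p : PtR ι ρ ν κ}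
    (hp : ¬ Leak p arm) (hu : ∀ j, p.1 j = y0 p) (hf : p.2.2.2.2 = f₀) (hA : idxA p = A)
    (hc : Core p arm) (hs : ∃ j, p.1 j = false) : p = obPtA arm A f₀ := by
  have hY : y0 p = false := by
    obtain ⟨j, hj⟩ := hs
    rw [← hu j, hj]
  rw [← slabPt_projA hp hu hf hA, obPtA]
  congr 1
  funext t
  rcases t with ⟨⟨⟩⟩ | ⟨i, hi⟩ | ⟨r, hr⟩
  · simpa [projA] using hY
  · simp only [projA, Sum.elim_inl, Sum.elim_inr]
    rw [hc.1 i]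
    have := (not_iff_not.2 (show arm i ∈ A ↔ p.2.2.1 (arm i) = y0 p by
      rw [← hA, idxA, Finset.mem_filter]; simp only [Finset.mem_univ, true_and])).1 hi
    rw [hY] at this
    simpa using this
  · simp only [projA, Sum.elim_inr]
    rw [← hc.2 r]
    have := (not_iff_not.2 (show r ∈ A ↔ p.2.2.1 r = y0 p by
      rw [← hA, idxA, Finset.mem_filter]; simp only [Finset.mem_univ, true_and])).1 hr
    rw [hY] at this
    simpa using this

end SlabVocab

end MixedArms

end Summit.Ventures.PercRepro2
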